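import Summits.CriticalPhenomena.CardyFormulaZ2.Theorems.CardySelfRefinementLagHandOffNoIdleAuxTraversal
import Summits.CriticalPhenomena.CardyFormulaZ2.Theorems.CardySelfRefinementLagHandOffNoIdleAuxLattice
import HarnessLib

/-!
# No idling of the limit interface, part 3: three shell traversals by the bond-`ℤ²`
exploration polygon force Garban's four-arm event (exploration half)

Helper file for the registered stub `stub_limitCurveRegularity_noIdle` of line
`hitting-tournament` of crux `LagHandOff` (stmt-CriticalPhenomena-10268).  THE DICTIONARY
(Smirnov–Werner 2001 §4 Rem. 6 / Aizenman–Burchard 1999 App. A, for the medial exploration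
polygon of bond percolation on `δℤ²`, in the cluster form of Garban's four-arm event): if the
exploration polygon of `ω` in admissible discrete Dobrushin data traverses a round shell
`D(x; ρ, R)` three separate times, far from both discrete boundary arcs, then around a lattice
centre `c` next to `x`, either `ω` or its dual configuration has two open crossings of the
square annulus `c + A_{m₁,n₁}` (`m₁δ ≈ 16ρ`, `n₁δ ≈ R/8`) lying in distinct open clusters of the
annulus (`fourArm_of_hasTraversals`).

Proof.  `traversal_data'` turns each traversal into a tight stretch of darts with a middle
dart; by the tree's winding-number lemma `sidePair_ne` the unordered pairs {left component,
right component} (components of the open annulus minus the perturbed polygon containing the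
left point, resp. the right point, of the middle dart) of the three stretches are pairwise
distinct, so for the first two stretches either the LEFT components differ or the RIGHT
components differ.  In the first case the chains of left vertices of the two stretches are
`ω`-open (`left_step_of_untainted`: no vertex is on the wired arc, by distance), cross the
annulus, and stay in their components (`cv_mem_connectedComponentIn`); open lattice edges in
the bulk are free of the polygon (`edge_of_mem_edgeTrace`: the polygon meets an edge only if it
crosses it, and a crossed edge of `Ω_δ` with no end on the dual-wired arc is closed), so the
separation principle `relabel_mem_fourArmTwoClusters_of_components` applies.  In the second
case the same holds for the chains of right faces, dual-open in `dualConfig ω`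
(`right_step_of_untainted`, `cf_mem_connectedComponentIn`, `exists_mem_bc_of_mem_centerSeg`).

References: S. Smirnov, W. Werner, Math. Res. Lett. 8 (2001) §4 Rem. 6; M. Aizenman,
A. Burchard, Duke Math. J. 99 (1999), App. A; C. Garban, App. B of O. Schramm, S. Smirnov,
Ann. Probab. 39 (2011), (B.2); S. Smirnov, C. R. Acad. Sci. 333 (2001) §2.
-/

noncomputable section

open MeasureTheory Filter Set Topology Metric
open scoped unitInterval
open Literature.Probability.Percolation Literature.Probability.LatticeModels
open Literature.Probability.RandomPlanarGeometry
open Literature.Probability.LatticeModels.IsMedialExploration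

namespace Summit.CriticalPhenomena.CardyFormulaZ2.Cruxes.LagHandOff.HittingTournament

variable {D' : DiscreteDobrushin} {ω : BondConfig (Site 2)} {a : MedialVertex}
  {l : List MedialVertex}

/-! ### The dictionary -/

/-- **Three separate traversals of a bulk shell by the exploration polygon force Garban's
four-arm event, for the configuration or for its dual.** Let the medial exploration polygon
of `ω` (a lattice configuration) in the discrete Dobrushin data `D'` (mesh `δ ≤ ρ`) traverse
the shell `D(x; ρ, R)`, `R ≥ 256ρ`, three separate times, where all sites of both discrete
boundary arcs are at distance `≥ R` from `x`; let `c` be a lattice site with `dist(δc, x) ≤ δ`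
and `1 ≤ m₁ ≤ n₁` with `16ρ + 4δ ≤ m₁δ`, `8n₁δ + 8δ < R`. Then `ω - c ∈ fourArmTwoClusters m₁ n₁`
or `dualConfig ω - c ∈ fourArmTwoClusters m₁ n₁` (two open, resp. dual-open, crossings of the
square annulus `A_{m₁,n₁}` around `c` in distinct clusters of the annulus). See the module
docstring for the proof. [cite: SmirnovWernerMRL2001, §4 Remark 6]
[cite: AizenmanBurchardDuke1999, Appendix A] -/
theorem fourArm_of_hasTraversals (hexp : IsMedialExploration D' ω (a :: l)) (hδ : 0 < D'.δ)
    (hωE : ω ⊆ (zdGraph 2).edgeSet) {x : ℂ} {ρ R : ℝ} (hδρ : D'.δ ≤ ρ) (hR : 256 * ρ ≤ R)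
    (hfarA : ∀ v ∈ D'.zdArcA, R ≤ dist (meshPoint D'.δ v) x)
    (hfarB : ∀ v ∈ D'.zdArcB, R ≤ dist (meshPoint D'.δ v) x)
    {c : Site 2} (hc : dist (meshPoint D'.δ c) x ≤ D'.δ) {m₁ n₁ : ℕ} (h1m : 1 ≤ m₁)
    (hmn : m₁ ≤ n₁) (hm₁ : 16 * ρ + 4 * D'.δ ≤ m₁ * D'.δ)
    (hn₁ : 8 * (n₁ : ℝ) * D'.δ + 8 * D'.δ < R)
    (htr : (⟨polyline ((a :: l).map (medialPoint D'.δ))⟩ : Curve ℂ).HasTraversals 3 x ρ R) :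
    BondConfig.relabel (sym2Equiv (Site.shift (-c))) ω ∈ fourArmTwoClusters m₁ n₁ ∨
      BondConfig.relabel (sym2Equiv (Site.shift (-c))) (dualConfig ω) ∈
        fourArmTwoClusters m₁ n₁ := by
  classical
  set δ := D'.δ with hδdef
  have hρ : 0 < ρ := hδ.trans_le hδρ
  set n := ((a :: l).zip l).length with hn
  set 𝔸 : Set ℂ := ball x (R / 2) \ closedBall x (4 * ρ) with h𝔸
  set X : Set ℂ := 𝔸 \ hexp.pertTrace with hX
  obtain ⟨sT, tT, htrav, hsep⟩ := htr
  have hdata := fun q : Fin 3 =>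
    traversal_data' hexp hδ hδρ (le_refl (16 : ℝ)) (by linarith : 16 * 16 * ρ ≤ R) (htrav q)
  choose m i' j' hspec using hdata
  have hm1 := fun q => (hspec q).1
  have hm2 := fun q => (hspec q).2.1
  have hi'm := fun q => (hspec q).2.2.1
  have hmj' := fun q => (hspec q).2.2.2.1
  have hsi' := fun q => (hspec q).2.2.2.2.1
  have hj't := fun q => (hspec q).2.2.2.2.2.1
  have hends := fun q => (hspec q).2.2.2.2.2.2.1
  have hside := fun q => (hspec q).2.2.2.2.2.2.2.1
  have hball := fun q => (hspec q).2.2.2.2.2.2.2.2.1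
  have hrad := fun q => (hspec q).2.2.2.2.2.2.2.2.2.1
  have hcends := fun q => (hspec q).2.2.2.2.2.2.2.2.2.2
  clear hspec
  have htn : ∀ q, tIdx l (tT q) < n := fun q => tIdx_lt_length hexp (tT q)
  have hmn' : ∀ q, m q < n := fun q => (hm2 q).trans (htn q)
  have hj'n : ∀ q, j' q < n := fun q => (hj't q).trans_lt (htn q)
  -- side components and their pairs
  set cL : Fin 3 → Set ℂ := fun q => connectedComponentIn X (hexp.leftPt (m q)) with hcL
  set cR : Fin 3 → Set ℂ := fun q => connectedComponentIn X (hexp.rightPt (m q)) with hcR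
  have horder : ∀ q q' : Fin 3, q ≠ q' → m q < tIdx l (sT q') ∨ tIdx l (tT q') < m q := by
    intro q q' hqq
    rcases lt_or_gt_of_ne hqq with h | h
    · left
      exact (hm2 q).trans_le (tIdx_mono l (hsep h).le)
    · right
      exact (tIdx_mono l (hsep h).le).trans_lt (hm1 q)
  have hk3 : 3 ≤ 3 := le_rfl
  have hpair : ∀ q q' : Fin 3, q ≠ q' → s(cL q, cR q) ≠ s(cL q', cR q') := by
    intro q q' hqq
    obtain ⟨c', hcq, hcq'⟩ := Fin.exists_ne_and_ne_of_two_lt q q' hk3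
    have hle' := ((hsi' q').trans (hi'm q')).trans ((hmj' q').trans (hj't q'))
    have hlec := ((hsi' c').trans (hi'm c')).trans ((hmj' c').trans (hj't c'))
    have key := hexp.sidePair_ne hδ (x := x) (r₁ := 4 * ρ) (r₂ := R / 2) (by positivity)
      (by linarith) (ma := m q) (mb := m q') (ib := tIdx l (sT q'))
      (kb := tIdx l (tT q') - tIdx l (sT q')) (ic := tIdx l (sT c'))
      (kc := tIdx l (tT c') - tIdx l (sT c')) (hmn' q)
      (by rw [Nat.add_sub_cancel' hle']; exact htn q')
      (by rw [Nat.add_sub_cancel' hlec]; exact htn c')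
      ⟨(hsi' q').trans (hi'm q'), by rw [Nat.add_sub_cancel' hle']; exact (hmj' q').trans (hj't q')⟩
      (by rw [Nat.add_sub_cancel' hle']; exact horder q q' hqq)
      (by rw [Nat.add_sub_cancel' hlec]; exact horder q c' (Ne.symm hcq))
      (by rw [Nat.add_sub_cancel' hlec]; exact horder q' c' (Ne.symm hcq'))
      (hside q) (hside q')
      (by rw [Nat.add_sub_cancel' hle']; exact hends q')
      (by rw [Nat.add_sub_cancel' hlec]; exact hends c')
    exact key
  -- the stretch vertices and faces are in the bulk
  have hcvA : ∀ q i, i' q ≤ i → i ≤ j' q → hexp.cv i ∉ D'.zdArcA := by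
    intro q i h1 h2 hA
    have := hfarA _ hA
    have := (hrad q i h1 h2).2
    linarith
  have hcvB : ∀ q i, i' q ≤ i → i ≤ j' q → hexp.cv i ∉ D'.zdArcB := by
    intro q i h1 h2 hB
    have := hfarB _ hB
    have := (hrad q i h1 h2).2
    linarith
  have hcfcv : ∀ i, i < n → dist (meshPoint δ (hexp.cv i)) (meshPoint δ (hexp.cf i)) ≤ 2 * δ :=
    fun i hi => dist_meshPoint_le_of_isCorner hδ.le (hexp.isCorner hi)
  have hcf_rad : ∀ q i, i' q ≤ i → i ≤ j' q →
      16 * ρ - 3 * δ ≤ dist (meshPoint δ (hexp.cf i)) x ∧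
        dist (meshPoint δ (hexp.cf i)) x ≤ R / 4 + 3 * δ := by
    intro q i h1 h2
    have hi : i < n := h2.trans_lt (hj'n q)
    obtain ⟨h3, h4⟩ := hrad q i h1 h2
    have h5 := hcfcv i hi
    constructor
    · linarith [dist_triangle (meshPoint δ (hexp.cv i)) (meshPoint δ (hexp.cf i)) x]
    · linarith [dist_triangle (meshPoint δ (hexp.cf i)) (meshPoint δ (hexp.cv i)) x,
        dist_comm (meshPoint δ (hexp.cv i)) (meshPoint δ (hexp.cf i))]
  have hcornerB : ∀ q i, i' q ≤ i → i ≤ j' q → ∀ u', IsCorner u' (hexp.cf i) →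
      u' ∉ D'.zdArcB := by
    intro q i h1 h2 u' hu' hB
    have := hfarB _ hB
    have h3 := (hcf_rad q i h1 h2).2
    have h4 := dist_meshPoint_le_of_isCorner hδ.le hu'
    linarith [dist_triangle (meshPoint δ u') (meshPoint δ (hexp.cf i)) x]
  have hcfA : ∀ q i, i' q ≤ i → i ≤ j' q → hexp.cf i ∉ D'.zdArcA := by
    intro q i h1 h2 hA
    have := hfarA _ hA
    have := (hcf_rad q i h1 h2).2
    linarith
  -- chain points lie in the side components
  have hball' : ∀ q i, i' q ≤ i → i ≤ j' q → closedBall (meshPoint δ (hexp.cv i)) δ ⊆ 𝔸 :=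
    fun q i h1 h2 => (closedBall_subset_closedBall (by linarith)).trans (hball q i h1 h2)
  have hvmem : ∀ q i, i' q ≤ i → i ≤ j' q → meshPoint δ (hexp.cv i) ∈ cL q := fun q i h1 h2 =>
    hexp.cv_mem_connectedComponentIn hδ (hj'n q) (hball' q) h1 h2 (hi'm q) (hmj' q)
  have hfmem : ∀ q i, i' q ≤ i → i ≤ j' q → (δ • faceCenter (hexp.cf i) : ℂ) ∈ cR q :=
    fun q i h1 h2 =>
    hexp.cf_mem_connectedComponentIn hδ (hj'n q) (hball' q) h1 h2 (hi'm q) (hmj' q)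
  -- arithmetic consequences of the hypotheses on `m₁`, `n₁`
  have hn₁' : 2 * (n₁ : ℝ) * δ + 2 * δ < R / 4 := by linarith
  have hn₁sub : 2 * ((n₁ - 1 : ℕ) : ℝ) * δ ≤ 2 * (n₁ : ℝ) * δ - 2 * δ := by
    have : ((n₁ - 1 : ℕ) : ℝ) = (n₁ : ℝ) - 1 := by
      rw [Nat.cast_sub (h1m.trans hmn)]; norm_num
    rw [this]; linarith
  have hm₁R : (m₁ : ℝ) * δ ≤ 2 * (n₁ : ℝ) * δ := by
    have : (m₁ : ℝ) ≤ n₁ := by exact_mod_cast hmn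
    nlinarith
  -- not in the small box from a large distance
  have hnotbox : ∀ v : Site 2, R / 4 - 4 * δ ≤ dist (meshPoint δ v) (meshPoint δ c) →
      v - c ∉ box 2 (n₁ - 1) := by
    intro v hv hbox
    have := dist_le_of_sub_mem_box hδ.le hbox
    linarith
  -- sites of the recentred square annulus, in distance from `x`
  have hann_dist : ∀ v : Site 2, v - c ∈ sqAnnulus m₁ n₁ →
      16 * ρ + 3 * δ ≤ dist (meshPoint δ v) x ∧ dist (meshPoint δ v) x ≤ R / 4 - δ := by
    intro v hv
    have h1 := le_dist_of_sub_mem_sqAnnulus hδ.le h1m hv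
    have h2 : v - c ∈ box 2 n₁ := by
      have : v - c ∈ (annulus 2 (m₁ - 1) n₁ : Set (Site 2)) := hv
      rw [Finset.mem_coe, mem_annulus] at this
      exact this.1
    have h3 := dist_le_of_sub_mem_box hδ.le h2
    constructor
    · linarith [dist_triangle (meshPoint δ v) x (meshPoint δ c), dist_comm x (meshPoint δ c)]
    · linarith [dist_triangle (meshPoint δ v) (meshPoint δ c) x]
  -- the dichotomy from the distinct side pairs of the first two stretches
  have h01 : (0 : Fin 3) ≠ 1 := by decide
  have hLR : cL 0 ≠ cL 1 ∨ cR 0 ≠ cR 1 := by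
    by_contra h
    push Not at h
    exact hpair 0 1 h01 (by rw [h.1, h.2])
  rcases hLR with hL | hRt
  · ---------------------------------------------------------------- left chains, `ω`
    left
    set S₀ : Set (Site 2) :=
      {v | 8 * ρ ≤ dist (meshPoint δ v) x ∧ dist (meshPoint δ v) x ≤ R / 4 + 2 * δ} with hS₀
    have hS₀B : ∀ v ∈ S₀, v ∉ D'.zdArcB := by
      intro v hv hB
      have := hfarB _ hB
      have := hv.2
      linarith
    have hseg : ∀ u w, u ∈ S₀ → w ∈ S₀ → (zdGraph 2).Adj u w → s(u, w) ∈ ω →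
        segment ℝ (meshPoint δ u) (meshPoint δ w) ⊆ X := by
      intro u w hu hw hadj huw z hz
      refine ⟨segment_subset_annulus (L := δ) hu.1 hu.2 ?_ (by linarith) (by linarith) hz,
        segment_meshPoint_disjoint_pertTrace hexp hδ hadj huw (hS₀B u hu) (hS₀B w hw) z hz⟩
      rw [dist_meshPoint_of_adj hadj, abs_of_pos hδ]
    have hann : ∀ v, v - c ∈ sqAnnulus m₁ n₁ → v ∈ S₀ := by
      intro v hv
      obtain ⟨h1, h2⟩ := hann_dist v hv
      exact ⟨by linarith, by linarith⟩
    -- one open connection per stretch, oriented inwards-out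
    have hconn : ∀ q : Fin 3, ∃ vi vo : Site 2, vi - c ∈ box 2 m₁ ∧ vo - c ∉ box 2 (n₁ - 1) ∧
        ω ∈ openConnIn S₀ vi vo ∧ meshPoint δ vi ∈ cL q := by
      intro q
      set f : ℕ → Site 2 := fun p => hexp.cv (i' q + p) with hf
      set N := j' q - i' q with hN
      have step : ∀ k, i' q ≤ k → k + 1 ≤ j' q →
          hexp.cv k = hexp.cv (k + 1) ∨ s(hexp.cv k, hexp.cv (k + 1)) ∈ ω := by
        intro k hk1 hk2
        rcases left_step_of_untainted hexp (i := k + 1) (by omega) (hk2.trans_lt (hj'n q))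
          (hcvA q (k + 1) (by omega) hk2) with h | ⟨h, -⟩
        · left; simpa only [Nat.add_sub_cancel] using h
        · right; simpa only [Nat.add_sub_cancel] using h
      have hchain : ∀ p < N, f p = f (p + 1) ∨ s(f p, f (p + 1)) ∈ ω := by
        intro p hp
        have h1 : i' q + p + 1 ≤ j' q := by rw [hN] at hp; omega
        have := step (i' q + p) (by omega) h1
        simpa only [hf, add_assoc] using this
      have hS : ∀ p ≤ N, f p ∈ S₀ := by
        intro p hp
        have h2 : i' q + p ≤ j' q := by rw [hN] at hp; have := hi'm q; have := hmj' q; omega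
        obtain ⟨h3, h4⟩ := hrad q (i' q + p) (by omega) h2
        exact ⟨by linarith, by linarith⟩
      have hc0 := openConnIn_of_chain f N hchain hS
      have hf0 : f 0 = hexp.cv (i' q) := by simp [hf]
      have hfN : f N = hexp.cv (j' q) := by
        simp only [hf, hN]
        rw [Nat.add_sub_cancel' ((hi'm q).trans (hmj' q))]
      rw [hf0, hfN] at hc0
      have hij : i' q ≤ j' q := (hi'm q).trans (hmj' q)
      rcases hcends q with ⟨h1, h2⟩ | ⟨h1, h2⟩
      · refine ⟨hexp.cv (i' q), hexp.cv (j' q), ?_, ?_, hc0, hvmem q _ le_rfl hij⟩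
        · refine sub_mem_box_of_dist_le hδ ?_
          linarith [dist_triangle (meshPoint δ (hexp.cv (i' q))) x (meshPoint δ c),
            dist_comm x (meshPoint δ c)]
        · refine hnotbox _ ?_
          linarith [dist_triangle (meshPoint δ (hexp.cv (j' q))) (meshPoint δ c) x]
      · refine ⟨hexp.cv (j' q), hexp.cv (i' q), ?_, ?_, (by rw [openConnIn_comm]; exact hc0),
          hvmem q _ hij le_rfl⟩
        · refine sub_mem_box_of_dist_le hδ ?_
          linarith [dist_triangle (meshPoint δ (hexp.cv (j' q))) x (meshPoint δ c),
            dist_comm x (meshPoint δ c)]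
        · refine hnotbox _ ?_
          linarith [dist_triangle (meshPoint δ (hexp.cv (i' q))) (meshPoint δ c) x]
    choose vi vo hvi hvo hco hvX using hconn
    have hcomp : ∀ q, connectedComponentIn X (meshPoint δ (vi q)) = cL q := fun q =>
      (connectedComponentIn_eq (hvX q)).symm
    refine relabel_mem_fourArmTwoClusters_of_components hωE (P := meshPoint δ) hseg h1m hmn hann
      (vin := ![vi 0, vi 1]) (vout := ![vo 0, vo 1]) ?_ ?_ ?_ ?_ ?_
    · intro q; fin_cases q <;> simp [hco]
    · intro q; fin_cases q <;> simp [hvi]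
    · intro q; fin_cases q
      · simpa using hvo 0
      · simpa using hvo 1
    · intro q; fin_cases q
      · simpa using connectedComponentIn_subset _ _ (hvX 0)
      · simpa using connectedComponentIn_subset _ _ (hvX 1)
    · simpa [hcomp] using hL
  · ---------------------------------------------------------------- right chains, dual
    right
    have hωd : dualConfig ω ⊆ (zdGraph 2).edgeSet := fun e he => (mem_dualConfig_iff.1 he).1
    set S₀ : Set (Site 2) :=
      {v | 9 * ρ ≤ dist (meshPoint δ v) x ∧ dist (meshPoint δ v) x ≤ R / 4 + 4 * δ} with hS₀
    have hS₀A : ∀ v ∈ S₀, v ∉ D'.zdArcA := by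
      intro v hv hA
      have := hfarA _ hA
      have := hv.2
      linarith
    set P : Site 2 → ℂ := fun f => δ • faceCenter f with hP
    have hPm : ∀ f, dist (P f) (meshPoint δ f) ≤ δ := fun f => dist_smul_faceCenter_meshPoint_le hδ f
    have hseg : ∀ u w, u ∈ S₀ → w ∈ S₀ → (zdGraph 2).Adj u w → s(u, w) ∈ dualConfig ω →
        segment ℝ (P u) (P w) ⊆ X := by
      intro u w hu hw hadj huw z hz
      have hPu1 : 9 * ρ - δ ≤ dist (P u) x := by
        linarith [dist_triangle (meshPoint δ u) (P u) x, dist_comm (P u) (meshPoint δ u), hPm u,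
          hu.1]
      have hPu2 : dist (P u) x ≤ R / 4 + 5 * δ := by
        linarith [dist_triangle (P u) (meshPoint δ u) x, hPm u, hu.2]
      have hL : dist (P u) (P w) ≤ 3 * δ := by
        have h1 := dist_meshPoint_of_adj (δ := δ) hadj
        rw [abs_of_pos hδ] at h1
        linarith [dist_triangle (P u) (meshPoint δ u) (P w),
          dist_triangle (meshPoint δ u) (meshPoint δ w) (P w), hPm u, hPm w,
          dist_comm (P w) (meshPoint δ w)]
      refine ⟨segment_subset_annulus hPu1 hPu2 hL (by linarith) (by linarith) hz,
        segment_faceCenter_disjoint_pertTrace hexp hδ hadj huw (hS₀A u hu) (hS₀A w hw) z hz⟩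
    have hann : ∀ v, v - c ∈ sqAnnulus m₁ n₁ → v ∈ S₀ := by
      intro v hv
      obtain ⟨h1, h2⟩ := hann_dist v hv
      exact ⟨by linarith, by linarith⟩
    have hconn : ∀ q : Fin 3, ∃ vi vo : Site 2, vi - c ∈ box 2 m₁ ∧ vo - c ∉ box 2 (n₁ - 1) ∧
        dualConfig ω ∈ openConnIn S₀ vi vo ∧ P vi ∈ cR q := by
      intro q
      set f : ℕ → Site 2 := fun p => hexp.cf (i' q + p) with hf
      set N := j' q - i' q with hN
      have step : ∀ k, i' q ≤ k → k + 1 ≤ j' q →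
          hexp.cf k = hexp.cf (k + 1) ∨ s(hexp.cf k, hexp.cf (k + 1)) ∈ dualConfig ω := by
        intro k hk1 hk2
        rcases right_step_of_untainted hexp (i := k + 1) (by omega) (hk2.trans_lt (hj'n q))
          (by simpa only [Nat.add_sub_cancel] using hcornerB q k hk1 (by omega)) with h | h
        · left; simpa only [Nat.add_sub_cancel] using h
        · right; simpa only [Nat.add_sub_cancel] using h
      have hchain : ∀ p < N, f p = f (p + 1) ∨ s(f p, f (p + 1)) ∈ dualConfig ω := by
        intro p hp
        have h1 : i' q + p + 1 ≤ j' q := by rw [hN] at hp; omega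
        have := step (i' q + p) (by omega) h1
        simpa only [hf, add_assoc] using this
      have hS : ∀ p ≤ N, f p ∈ S₀ := by
        intro p hp
        have h2 : i' q + p ≤ j' q := by rw [hN] at hp; have := hi'm q; have := hmj' q; omega
        obtain ⟨h3, h4⟩ := hcf_rad q (i' q + p) (by omega) h2
        exact ⟨by linarith, by linarith⟩
      have hc0 := openConnIn_of_chain f N hchain hS
      have hf0 : f 0 = hexp.cf (i' q) := by simp [hf]
      have hfN : f N = hexp.cf (j' q) := by
        simp only [hf, hN]
        rw [Nat.add_sub_cancel' ((hi'm q).trans (hmj' q))]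
      rw [hf0, hfN] at hc0
      have hij : i' q ≤ j' q := (hi'm q).trans (hmj' q)
      have hi'n : i' q < n := hij.trans_lt (hj'n q)
      rcases hcends q with ⟨h1, h2⟩ | ⟨h1, h2⟩
      · refine ⟨hexp.cf (i' q), hexp.cf (j' q), ?_, ?_, hc0, hfmem q _ le_rfl hij⟩
        · refine sub_mem_box_of_dist_le hδ ?_
          linarith [dist_triangle (meshPoint δ (hexp.cf (i' q))) x (meshPoint δ c),
            dist_comm x (meshPoint δ c), hcfcv (i' q) hi'n,
            dist_triangle (meshPoint δ (hexp.cf (i' q))) (meshPoint δ (hexp.cv (i' q))) x,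
            dist_comm (meshPoint δ (hexp.cv (i' q))) (meshPoint δ (hexp.cf (i' q)))]
        · refine hnotbox _ ?_
          linarith [dist_triangle (meshPoint δ (hexp.cv (j' q))) (meshPoint δ (hexp.cf (j' q)))
              (meshPoint δ c), hcfcv (j' q) (hj'n q),
            dist_triangle (meshPoint δ (hexp.cv (j' q))) (meshPoint δ c) x]
      · refine ⟨hexp.cf (j' q), hexp.cf (i' q), ?_, ?_, (by rw [openConnIn_comm]; exact hc0),
          hfmem q _ hij le_rfl⟩
        · refine sub_mem_box_of_dist_le hδ ?_
          linarith [dist_triangle (meshPoint δ (hexp.cf (j' q))) x (meshPoint δ c),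
            dist_comm x (meshPoint δ c), hcfcv (j' q) (hj'n q),
            dist_triangle (meshPoint δ (hexp.cf (j' q))) (meshPoint δ (hexp.cv (j' q))) x,
            dist_comm (meshPoint δ (hexp.cv (j' q))) (meshPoint δ (hexp.cf (j' q)))]
        · refine hnotbox _ ?_
          linarith [dist_triangle (meshPoint δ (hexp.cv (i' q))) (meshPoint δ (hexp.cf (i' q)))
              (meshPoint δ c), hcfcv (i' q) hi'n,
            dist_triangle (meshPoint δ (hexp.cv (i' q))) (meshPoint δ c) x]
    choose vi vo hvi hvo hco hvX using hconn
    have hcomp : ∀ q, connectedComponentIn X (P (vi q)) = cR q := fun q =>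
      (connectedComponentIn_eq (hvX q)).symm
    refine relabel_mem_fourArmTwoClusters_of_components hωd (P := P) hseg h1m hmn hann
      (vin := ![vi 0, vi 1]) (vout := ![vo 0, vo 1]) ?_ ?_ ?_ ?_ ?_
    · intro q; fin_cases q <;> simp [hco]
    · intro q; fin_cases q <;> simp [hvi]
    · intro q; fin_cases q
      · simpa using hvo 0
      · simpa using hvo 1
    · intro q; fin_cases q
      · simpa using connectedComponentIn_subset _ _ (hvX 0)
      · simpa using connectedComponentIn_subset _ _ (hvX 1)
    · simpa [hcomp] using hRt

/-- **Registered sub-stub `stub_noIdle_fourArm`** (line `hitting-tournament`, stub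
`stub_limitCurveRegularity_noIdle`, helper 3): the dictionary `fourArm_of_hasTraversals` with
all arguments explicit. [cite: SmirnovWernerMRL2001, §4 Remark 6] -/
theorem stub_noIdle_fourArm : ∀ (D' : DiscreteDobrushin) (ω : BondConfig (Site 2)) (a : MedialVertex) (l : List MedialVertex), IsMedialExploration D' ω (a :: l) → 0 < D'.δ → ω ⊆ (zdGraph 2).edgeSet → ∀ (x : ℂ) (ρ R : ℝ), D'.δ ≤ ρ → 256 * ρ ≤ R → (∀ v ∈ D'.zdArcA, R ≤ dist (meshPoint D'.δ v) x) → (∀ v ∈ D'.zdArcB, R ≤ dist (meshPoint D'.δ v) x) → ∀ (c : Site 2), dist (meshPoint D'.δ c) x ≤ D'.δ → ∀ (m₁ n₁ : ℕ), 1 ≤ m₁ → m₁ ≤ n₁ → 16 * ρ + 4 * D'.δ ≤ m₁ * D'.δ → 8 * (n₁ : ℝ) * D'.δ + 8 * D'.δ < R → (⟨polyline ((a :: l).map (medialPoint D'.δ))⟩ : Curve ℂ).HasTraversals 3 x ρ R → BondConfig.relabel (sym2Equiv (Site.shift (-c))) ω ∈ fourArmTwoClusters m₁ n₁ ∨ BondConfig.relabel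 (sym2Equiv (Site.shift (-c))) (dualConfig ω) ∈ fourArmTwoClusters m₁ n₁ :=
  fun _ _ _ _ hexp hδ hωE _ _ _ hδρ hR hfarA hfarB _ hc _ _ h1m hmn hm₁ hn₁ htr =>
    fourArm_of_hasTraversals hexp hδ hωE hδρ hR hfarA hfarB hc h1m hmn hm₁ hn₁ htr

end Summit.CriticalPhenomena.CardyFormulaZ2.Cruxes.LagHandOff.HittingTournament

end
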